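import Summits.QuantumFields.YangMills.Theorems.F4SubCurvatureDoorShortRootRigiditySliceDensity
import Mathlib
import HarnessLib

/-!
# OddModeRigidity — the typed three-way split (ym-idea-3 g21; crux ⟨stmt-QuantumFields-23035⟩, registered stub `:146 stub_oddModeRigidity`)

`OddModeRigidity` (verbatim below) ⇐ `AnalyticHalf ∧ TorusReduction ∧ TrigonalInjectivityAll`, where
* `NoBadModes L` — the degree-`L` polynomial shadow of `OddModeRigidity` (same hypotheses, `K := eval h`): TRUE for every `L` on paper
  (`Cruxes/ShortRootRigidity/TrigonalInjectivity.md` §2; odd `L` and `L = 0` trivially);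
* `AnalyticHalf` (R-O1, S–M): degree-wise spherical-harmonic projection of a continuous `InClass` kernel commutes with the `O(4)` action
  (channel projector ✓`Literature.Analysis.Potential.integral_radial_mul_harmonic_eq_zero`), all projections of degree ≥ 1 vanish ⇒ radial;
* `TorusReduction` (§2, M–L): torus weights `(q,n)` of `Harm_L(ℝ⁴)` w.r.t. `SO(2)_{Π₀^⊥} × SO(2)_{Π₀}` have multiplicity one; the support
  condition makes the even-`q` part `Σ λ_q W_q`; `⟨j0;j0|20⟩ ≠ 0`, stretched Clebsch–Gordan `≠ 0`; induction on `s` using `TrigonalInjectivity s`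
  at level `ℓ = 6s` (the planar trace of an `O_h`-invariant harmonic with vanishing low `6ℤ`-weights is sectoral — step (1) of §1);
* `TrigonalInjectivityAll` (§1, M, ELEMENTARY): Schwarz reflection across the four planes `⊥ (±1,±1,±1)`, the point `p = (2,1,3)/√14`, and
  `Re(2+√-3)^(6s) ≡ 4 (mod 7)` (kernel-checked: `Cruxes/ShortRootRigidity/TrigonalArithmetic.lean`, `re_pow_six_mul_ne_one`).
HONEST LABEL: this file only TYPES the split and proves the one-line composition; the three pieces, `OddModeRigidity`, ⟨23035⟩, ⟨23125⟩,
R2d and every summit are OPEN in the tree.  No summit is proved by a line.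
-/

noncomputable section

namespace Summit.QuantumFields.YangMills.Cruxes.ShortRootRigidity.OddModeSplit

open scoped BigOperators RealInnerProductSpace
open MvPolynomial
open Summit.QuantumFields.YangMills.Cruxes.OSLegsAtWeakCouplingC.Sketch (IsSignedPerm)
open Summit.QuantumFields.YangMills.Theorems.F4SubCurvatureDoorMirrorAnalyticityRegistered (E4 InClass)
open Summit.QuantumFields.YangMills.Theorems.F4SubCurvatureDoorSliceDensityRegistered
  (E2 planeEmb perpEmb EvenPartSliceInvariant)

/-- Obligation (4) «ODD-MODE RIGIDITY» (verbatim, shared with g19-A :149 / g20-A :145 / g21-C :146). [problem-side definition] -/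
def OddModeRigidity : Prop :=
  ∀ K : E4 → ℝ, InClass K → EvenPartSliceInvariant K → ∀ (R : E4 ≃ₗᵢ[ℝ] E4) (x : E4), K (R x) = K x

/-- A polynomial on `ℝ⁴` read as a kernel `E4 → ℝ`. -/
def pev (h : MvPolynomial (Fin 4) ℝ) (x : E4) : ℝ := eval (fun i => x i) h

/-- **NoBadModes L**: the degree-`L` shadow of `OddModeRigidity` — a harmonic homogeneous polynomial of degree `L` on `ℝ⁴`, invariant under
the signed permutations and with even part slice-invariant along `Π₀`, is `O(4)`-invariant (hence `0` when `L ≥ 1`). [problem-side definition] -/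
def NoBadModes (L : ℕ) : Prop :=
  ∀ h : MvPolynomial (Fin 4) ℝ, h.IsHomogeneous L → (∑ i, pderiv i (pderiv i h) = 0) →
    (∀ R : E4 ≃ₗᵢ[ℝ] E4, IsSignedPerm R → ∀ x : E4, pev h (R x) = pev h x) →
    EvenPartSliceInvariant (pev h) →
    ∀ (R : E4 ≃ₗᵢ[ℝ] E4) (x : E4), pev h (R x) = pev h x

/-- R-O1, the ANALYTIC HALF. [problem-side definition] -/
def AnalyticHalf : Prop := (∀ L : ℕ, NoBadModes L) → OddModeRigidity

/-- The point `u f₁ + v f₂` of the plane `x + y + z = 0`, `f₁ = (1,−1,0)/√2` (a 2-fold axis of the cube), `f₂ = (1,1,−2)/√6 = d₀ × f₁`. -/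
def planePt (u v : ℝ) : Fin 3 → ℝ :=
  ![u / Real.sqrt 2 + v / Real.sqrt 6, -(u / Real.sqrt 2) + v / Real.sqrt 6, -(2 * v / Real.sqrt 6)]

/-- **TrigonalInjectivity s** (= (P_s) of the note, in trace form): an `O_h`-invariant harmonic homogeneous polynomial of degree `6s` on `ℝ³`
whose trace on the plane `⊥ (1,1,1)` is sectoral, `a · Re (u + i v)^(6s)`, vanishes identically. [problem-side definition] -/
def TrigonalInjectivity (s : ℕ) : Prop :=
  ∀ Y : MvPolynomial (Fin 3) ℝ, Y.IsHomogeneous (6 * s) → (∑ i, pderiv i (pderiv i Y) = 0) →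
    (∀ σ : Equiv.Perm (Fin 3), rename σ Y = Y) →
    (∀ i : Fin 3, aeval (fun j : Fin 3 => if j = i then -(X j : MvPolynomial (Fin 3) ℝ) else X j) Y = Y) →
    (∃ a : ℝ, ∀ u v : ℝ, eval (planePt u v) Y = a * (((u : ℂ) + (v : ℂ) * Complex.I) ^ (6 * s)).re) →
    Y = 0

/-- §1 of the note, all `s`. [problem-side definition] -/
def TrigonalInjectivityAll : Prop := ∀ s : ℕ, 1 ≤ s → TrigonalInjectivity s

/-- §2 of the note: the torus-weight reduction. [problem-side definition] -/
def TorusReduction : Prop := TrigonalInjectivityAll → ∀ L : ℕ, NoBadModes L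

/-- The split composes (one line); the content is in the three pieces. -/
theorem oddModeRigidity_of_split (h₁ : AnalyticHalf) (h₂ : TorusReduction) (h₃ : TrigonalInjectivityAll) :
    OddModeRigidity :=
  h₁ (h₂ h₃)

/-- Sanity: `NoBadModes 0` holds outright (a degree-0 polynomial is constant). -/
theorem noBadModes_zero : NoBadModes 0 := by
  intro h hhom _ _ _ R x
  -- a homogeneous polynomial of degree 0 is the constant `coeff 0 h`
  have hc : h = C (coeff 0 h) := by
    have := hhom.totalDegree_le
    exact (MvPolynomial.totalDegree_eq_zero_iff_eq_C).mp (Nat.le_zero.mp this)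
  unfold pev
  rw [hc, eval_C, eval_C]

end Summit.QuantumFields.YangMills.Cruxes.ShortRootRigidity.OddModeSplit
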